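import Summits.Ventures.Crystal3D.Theorems.StickyWulffConstantTextureLiminfLineCountGlueOneSided
import Summits.Ventures.Crystal3D.Theorems.StickyWulffConstantTextureLiminfLayerCount
import Summits.Ventures.Crystal3D.Theorems.StickyWulffConstantTextureLiminfZigOrRows
import HarnessLib

/-!
# The covered wall cell from a ONE-SIDED count of IN-LAYER ROWS on EVERY layer (T-side of the «LAYER ROWS» line, R3)
# (lane T, crux `TextureLiminfV5`, stmt-Ventures-23912, EDGE-ON flux sliver `stub_edgeOnFlux`; cf-p1 RULING (ccix) 2026-08-29T11:16:36Z, item (R3))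

HONEST FRAMING. Venture `Summits/Ventures/Crystal3D` (cell `crystal3d-full`), route `route-Ventures-StickyWulffConstant`, helper
`--supports` the law-v5 crux `TextureLiminfV5` (stmt-Ventures-23912).  Bookkeeping only, standard axioms; nothing about any wall law is
claimed beyond the stated implications; rung F-C1 not moved.  NOT lane G's in-layer machine (R1, 19480-p2) and NOT its E1h debt (R2).

WHAT.  Line «LAYER ROWS» ((ccix): the flux-pair sliver has both plate axes within `13°` of the wall plane — `…FluxPairSteerTilt`, p714812 —
so plate 1's steepest in-layer row rises by `≥ (√3/2)·√(19/20) > √2·13/25` on EVERY layer; one uniform family of straight in-layer rows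
pays ONE-SIDEDLY).  The flux side is wulff-p2's uniform in-layer count `layer_lines_ge_flux` (…LayerCount: `layerFlux τ₀ L e · |S| ≤ #rows
with a site in the window`, rows indexed by `(layer, row) ∈ ℤ × ℤ`, sites `layerSite σ L e k i j`).  This file is the one-family glue, the
in-layer twin of `…LineCountGlueOneSided`:
* `two_charge_le_lines_layerRows_inner` / `…_top` — a table dominated by HALF plate 1's (resp. plate 2's) layer flux,
  `c i j ≤ layerFlux τ₀ L₁ e₃ / 2` (constant in `i, j`), has slice charge `2Q(wallSlice ρ′) ≤ #T`, `T ⊇` the rows with a site in the window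
  `[−R₀−4, −R₀−3]` (resp. `[h+R₀+3, h+R₀+4]`) at lateral `≤ ρ′ + 4R₀ + 36` (resp. `+ 4h`);
* `cell_charge_le_lines_layerRows_margin` / `…_top` — `2Q(wallSlice ρ) ≤ #T + 80(R₀+9)(1+h)ρ + 18mρ` (rim + margin at `√2` per unit volume);
* **`bilayerWallAt_of_lineCount_layerRows`** / **`…_top`** — the R1-at DELIVERABLE SHAPE (per cell: `m ≥ 0`, a finite `T ⊇` {window rows at
  lateral `≤ ρ − m`} in the row convention of `bilayerWallAt_of_lineCount_comb`'s `T₃`/`T₄`, and `#T + 18mρ ≤ Σ_PAY(12 − deg) + C_w(1+h)ρ`) ⇒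
  `BilayerWallAt ((C_w + 80(R₀+9) + 3456 + 1152(R₀+1))/2) R₀ σ₁ σ₂ L₁ L₂ s₁ s₂ c` for every table dominated by half the layer flux.
The certificate / cover / cut against `FluxPairFailAt` (`layerRows_dominate_of_tilt`: `⟪L₁e₃,e₃⟫² < 1/20 ⇒ 13/25 ≤ layerFlux (1/4) L₁ e₃ / 2`) is the
companion file once 19480-p2's R1-at signature and '…EdgeOnRepCover' are in the tree.
WHAT THIS IS NOT: not R1 (the in-layer walk machine and its END ⇒ pays), not E1h; F-C1 not moved.
-/

noncomputable section

namespace Summit.Ventures.Crystal3D.Theorems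

open MeasureTheory Set
open scoped ENNReal InnerProductSpace
open Literature.MathematicalPhysics.StatisticalMechanics (IsHaggSeq triangularVec₁ triangularVec₂)
open Summit.Ventures.Crystal3D.Cruxes.TextureLiminf.TexShadow (E3 e₃ cyl stacking laySlab layerRise layerFlux layerFlux_nonneg
  layerFlux_le_sqrt_two BilayerWallAt)

/-! ## The inner one-family counts -/

/-- **Inner one-family in-layer count, bottom plate.**  On the slice of radius `ρ′`, a table dominated by HALF plate 1's layer flux
(`c i j ≤ layerFlux τ₀ L₁ e₃ / 2`, `1/4 ≤ τ₀`) has charge `2Q ≤ #T`, `T` any finite set containing the rows `(k, j)` of plate 1 with a site in the window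
`[−R₀−4, −R₀−3] × {lateral ≤ ρ′ + 4R₀ + 36}`. -/
theorem two_charge_le_lines_layerRows_inner (σ₁ : ℤ → ℤ) (L₁ L₂ : E3 ≃ₗᵢ[ℝ] E3) (s₁ s₂ : E3) (τ₀ R₀ ρ' : ℝ) (hτ₀ : 1 / 4 ≤ τ₀)
    (hR₀ : 1 ≤ R₀) (hρ' : 0 ≤ ρ') (c : ℤ → ℤ → ℝ) (hc0 : ∀ i j, 0 ≤ c i j) (hdom : ∀ i j, c i j ≤ layerFlux τ₀ L₁ e₃ / 2)
    (T : Finset (ℤ × ℤ))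
    (hT : ∀ kj : ℤ × ℤ, (∃ i : ℤ,
        -R₀ - 4 ≤ (L₁ (layerSite σ₁ L₁ e₃ kj.1 i kj.2) + s₁) 2 ∧ (L₁ (layerSite σ₁ L₁ e₃ kj.1 i kj.2) + s₁) 2 ≤ -R₀ - 3 ∧
        Real.sqrt ((L₁ (layerSite σ₁ L₁ e₃ kj.1 i kj.2) + s₁) 0 ^ 2 + (L₁ (layerSite σ₁ L₁ e₃ kj.1 i kj.2) + s₁) 1 ^ 2) ≤
          ρ' + 4 * R₀ + 36) → kj ∈ T) :
    2 * ∑' ij : ℤ × ℤ, c ij.1 ij.2 * (volume (wallSlice ρ' ∩ laySlab L₁ s₁ ij.1 ∩ laySlab L₂ s₂ ij.2)).toReal ≤ (T.card : ℝ) := by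
  have he₃ : ‖(e₃ : E3)‖ = 1 := by rw [e₃, PiLp.norm_single, norm_one]
  have hi₃ : ∀ p : E3, ⟪p, e₃⟫_ℝ = p 2 := fun p => by
    rw [e₃, EuclideanSpace.inner_single_right]; simp
  have hSfin : volume (wallSlice ρ') ≠ ⊤ := by rw [volume_wallSlice ρ' hρ']; exact ENNReal.ofReal_ne_top
  have h1 := two_charge_le_const L₁ L₂ s₁ s₂ c (layerFlux τ₀ L₁ e₃ / 2) hc0 hdom (wallSlice ρ') (measurableSet_wallSlice ρ') hSfin
  have hsub : wallSlice ρ' ⊆ {p : E3 | (0 : ℝ) ≤ ⟪p, e₃⟫_ℝ ∧ ⟪p, e₃⟫_ℝ ≤ 0 + 1 ∧ Real.sqrt (p 0 ^ 2 + p 1 ^ 2) ≤ ρ'} := by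
    rintro p ⟨hp1, hp2, hp3⟩
    refine ⟨by rw [hi₃]; exact hp1, by rw [hi₃]; linarith, ?_⟩
    rw [← Real.sqrt_sq hρ']; exact Real.sqrt_le_sqrt hp3
  have h2 := layer_lines_ge_flux σ₁ L₁ s₁ e₃ he₃ τ₀ hτ₀ ρ' 0 (-R₀ - 4) (by linarith) (wallSlice ρ') (measurableSet_wallSlice ρ') hsub T
    (fun kj ⟨i, hk1, hk2, hk3⟩ => hT kj ⟨i, by rw [hi₃] at hk1; linarith, by rw [hi₃] at hk2; linarith, hk3.trans (by linarith)⟩)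
  have h3 : 2 * (layerFlux τ₀ L₁ e₃ / 2) * (volume (wallSlice ρ')).toReal = layerFlux τ₀ L₁ e₃ * (volume (wallSlice ρ')).toReal := by ring
  linarith

/-- **Inner one-family in-layer count, top plate** (toward `−e₃`; window `[h+R₀+3, h+R₀+4] × {lateral ≤ ρ′ + 4h + 4R₀ + 36}`). -/
theorem two_charge_le_lines_layerRows_inner_top (σ₂ : ℤ → ℤ) (L₁ L₂ : E3 ≃ₗᵢ[ℝ] E3) (s₁ s₂ : E3) (τ₀ R₀ h ρ' : ℝ)
    (hτ₀ : 1 / 4 ≤ τ₀) (hR₀ : 1 ≤ R₀) (hh : 0 ≤ h) (hρ' : 0 ≤ ρ') (c : ℤ → ℤ → ℝ) (hc0 : ∀ i j, 0 ≤ c i j)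
    (hdom : ∀ i j, c i j ≤ layerFlux τ₀ L₂ (-e₃) / 2) (T : Finset (ℤ × ℤ))
    (hT : ∀ kj : ℤ × ℤ, (∃ i : ℤ,
        h + R₀ + 3 ≤ (L₂ (layerSite σ₂ L₂ (-e₃) kj.1 i kj.2) + s₂) 2 ∧
        (L₂ (layerSite σ₂ L₂ (-e₃) kj.1 i kj.2) + s₂) 2 ≤ h + R₀ + 4 ∧
        Real.sqrt ((L₂ (layerSite σ₂ L₂ (-e₃) kj.1 i kj.2) + s₂) 0 ^ 2 +
          (L₂ (layerSite σ₂ L₂ (-e₃) kj.1 i kj.2) + s₂) 1 ^ 2) ≤ ρ' + 4 * h + 4 * R₀ + 36) → kj ∈ T) :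
    2 * ∑' ij : ℤ × ℤ, c ij.1 ij.2 * (volume (wallSlice ρ' ∩ laySlab L₁ s₁ ij.1 ∩ laySlab L₂ s₂ ij.2)).toReal ≤ (T.card : ℝ) := by
  have he₃ : ‖(e₃ : E3)‖ = 1 := by rw [e₃, PiLp.norm_single, norm_one]
  have hne₃ : ‖(-e₃ : E3)‖ = 1 := by rw [norm_neg, he₃]
  have hi₃ : ∀ p : E3, ⟪p, e₃⟫_ℝ = p 2 := fun p => by
    rw [e₃, EuclideanSpace.inner_single_right]; simp
  have hSfin : volume (wallSlice ρ') ≠ ⊤ := by rw [volume_wallSlice ρ' hρ']; exact ENNReal.ofReal_ne_top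
  have h1 := two_charge_le_const L₁ L₂ s₁ s₂ c (layerFlux τ₀ L₂ (-e₃) / 2) hc0 hdom (wallSlice ρ') (measurableSet_wallSlice ρ') hSfin
  have hsub : wallSlice ρ' ⊆ {p : E3 | (-1 : ℝ) ≤ ⟪p, -e₃⟫_ℝ ∧ ⟪p, -e₃⟫_ℝ ≤ -1 + 1 ∧ Real.sqrt (p 0 ^ 2 + p 1 ^ 2) ≤ ρ'} := by
    rintro p ⟨hp1, hp2, hp3⟩
    refine ⟨by rw [inner_neg_right, hi₃]; linarith, by rw [inner_neg_right, hi₃]; linarith, ?_⟩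
    rw [← Real.sqrt_sq hρ']; exact Real.sqrt_le_sqrt hp3
  have h2 := layer_lines_ge_flux σ₂ L₂ s₂ (-e₃) hne₃ τ₀ hτ₀ ρ' (-1) (-h - R₀ - 4) (by linarith) (wallSlice ρ')
    (measurableSet_wallSlice ρ') hsub T
    (fun kj ⟨i, hk1, hk2, hk3⟩ => hT kj ⟨i, by rw [inner_neg_right, hi₃] at hk2; linarith,
      by rw [inner_neg_right, hi₃] at hk1; linarith, hk3.trans (by linarith)⟩)
  have h3 : 2 * (layerFlux τ₀ L₂ (-e₃) / 2) * (volume (wallSlice ρ')).toReal = layerFlux τ₀ L₂ (-e₃) * (volume (wallSlice ρ')).toReal := by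
    ring
  linarith

/-! ## The cell form: rim + margin -/

/-- **One-sided in-layer cell bound, bottom plate, with margin**: `2Q(wallSlice ρ) ≤ #T + 80(R₀+9)(1+h)ρ + 18mρ` for a table dominated by half
plate 1's layer flux and a finite `T` containing plate 1's rows with a site in `[−R₀−4, −R₀−3] × {lateral ≤ ρ − m}`. -/
theorem cell_charge_le_lines_layerRows_margin (σ₁ : ℤ → ℤ) (L₁ L₂ : E3 ≃ₗᵢ[ℝ] E3) (s₁ s₂ : E3) (τ₀ R₀ h ρ : ℝ)
    (hτ₀ : 1 / 4 ≤ τ₀) (hR₀ : 1 ≤ R₀) (hh : 0 ≤ h) (hρ : 0 ≤ ρ) (c : ℤ → ℤ → ℝ) (hc0 : ∀ i j, 0 ≤ c i j)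
    (hdom : ∀ i j, c i j ≤ layerFlux τ₀ L₁ e₃ / 2) (m : ℝ) (hm : 0 ≤ m) (T : Finset (ℤ × ℤ))
    (hT : ∀ kj : ℤ × ℤ, (∃ i : ℤ,
        -R₀ - 4 ≤ (L₁ (layerSite σ₁ L₁ e₃ kj.1 i kj.2) + s₁) 2 ∧ (L₁ (layerSite σ₁ L₁ e₃ kj.1 i kj.2) + s₁) 2 ≤ -R₀ - 3 ∧
        Real.sqrt ((L₁ (layerSite σ₁ L₁ e₃ kj.1 i kj.2) + s₁) 0 ^ 2 + (L₁ (layerSite σ₁ L₁ e₃ kj.1 i kj.2) + s₁) 1 ^ 2) ≤ ρ - m) →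
        kj ∈ T) :
    2 * ∑' ij : ℤ × ℤ, c ij.1 ij.2 * (volume (wallSlice ρ ∩ laySlab L₁ s₁ ij.1 ∩ laySlab L₂ s₂ ij.2)).toReal ≤
      (T.card : ℝ) + 80 * (R₀ + 9) * (1 + h) * ρ + 18 * m * ρ := by
  have he₃ : ‖(e₃ : E3)‖ = 1 := by rw [e₃, PiLp.norm_single, norm_one]
  have hcB : ∀ i j, c i j ≤ Real.sqrt 2 := fun i j =>
    (hdom i j).trans (by linarith [layerFlux_le_sqrt_two τ₀ L₁ he₃, layerFlux_nonneg τ₀ L₁ e₃])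
  set d : ℝ := 4 * h + 4 * R₀ + 36 with hd
  have hRh : 0 ≤ (R₀ + 9) * (1 + h) := mul_nonneg (by linarith) (by linarith)
  have hdle : 18 * d * ρ ≤ 80 * (R₀ + 9) * (1 + h) * ρ := by
    have h1 : 18 * d ≤ 80 * (R₀ + 9) * (1 + h) := by rw [hd]; nlinarith
    nlinarith
  have hmain := two_charge_wallSlice_le_of_inner L₁ L₂ s₁ s₂ c hc0 hcB (ρ := ρ) (M := m + d) (N := (T.card : ℝ)) hρ
    (by rw [hd]; linarith) (Nat.cast_nonneg _) (fun _ =>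
      two_charge_le_lines_layerRows_inner σ₁ L₁ L₂ s₁ s₂ τ₀ R₀ (ρ - (m + d)) hτ₀ hR₀ (by linarith) c hc0 hdom T
        (fun kj ⟨i, hk1, hk2, hk3⟩ => hT kj ⟨i, hk1, hk2, hk3.trans (by rw [hd]; linarith)⟩))
  linarith

/-- **One-sided in-layer cell bound, top plate, with margin** (window `[h+R₀+3, h+R₀+4] × {lateral ≤ ρ − m}`). -/
theorem cell_charge_le_lines_layerRows_margin_top (σ₂ : ℤ → ℤ) (L₁ L₂ : E3 ≃ₗᵢ[ℝ] E3) (s₁ s₂ : E3) (τ₀ R₀ h ρ : ℝ)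
    (hτ₀ : 1 / 4 ≤ τ₀) (hR₀ : 1 ≤ R₀) (hh : 0 ≤ h) (hρ : 0 ≤ ρ) (c : ℤ → ℤ → ℝ) (hc0 : ∀ i j, 0 ≤ c i j)
    (hdom : ∀ i j, c i j ≤ layerFlux τ₀ L₂ (-e₃) / 2) (m : ℝ) (hm : 0 ≤ m) (T : Finset (ℤ × ℤ))
    (hT : ∀ kj : ℤ × ℤ, (∃ i : ℤ,
        h + R₀ + 3 ≤ (L₂ (layerSite σ₂ L₂ (-e₃) kj.1 i kj.2) + s₂) 2 ∧
        (L₂ (layerSite σ₂ L₂ (-e₃) kj.1 i kj.2) + s₂) 2 ≤ h + R₀ + 4 ∧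
        Real.sqrt ((L₂ (layerSite σ₂ L₂ (-e₃) kj.1 i kj.2) + s₂) 0 ^ 2 +
          (L₂ (layerSite σ₂ L₂ (-e₃) kj.1 i kj.2) + s₂) 1 ^ 2) ≤ ρ - m) → kj ∈ T) :
    2 * ∑' ij : ℤ × ℤ, c ij.1 ij.2 * (volume (wallSlice ρ ∩ laySlab L₁ s₁ ij.1 ∩ laySlab L₂ s₂ ij.2)).toReal ≤
      (T.card : ℝ) + 80 * (R₀ + 9) * (1 + h) * ρ + 18 * m * ρ := by
  have he₃ : ‖(e₃ : E3)‖ = 1 := by rw [e₃, PiLp.norm_single, norm_one]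
  have hne₃ : ‖(-e₃ : E3)‖ = 1 := by rw [norm_neg, he₃]
  have hcB : ∀ i j, c i j ≤ Real.sqrt 2 := fun i j =>
    (hdom i j).trans (by linarith [layerFlux_le_sqrt_two τ₀ L₂ hne₃, layerFlux_nonneg τ₀ L₂ (-e₃)])
  set d : ℝ := 4 * h + 4 * R₀ + 36 with hd
  have hRh : 0 ≤ (R₀ + 9) * (1 + h) := mul_nonneg (by linarith) (by linarith)
  have hdle : 18 * d * ρ ≤ 80 * (R₀ + 9) * (1 + h) * ρ := by
    have h1 : 18 * d ≤ 80 * (R₀ + 9) * (1 + h) := by rw [hd]; nlinarith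
    nlinarith
  have hmain := two_charge_wallSlice_le_of_inner L₁ L₂ s₁ s₂ c hc0 hcB (ρ := ρ) (M := m + d) (N := (T.card : ℝ)) hρ
    (by rw [hd]; linarith) (Nat.cast_nonneg _) (fun _ =>
      two_charge_le_lines_layerRows_inner_top σ₂ L₁ L₂ s₁ s₂ τ₀ R₀ h (ρ - (m + d)) hτ₀ hR₀ hh (by linarith) c hc0 hdom T
        (fun kj ⟨i, hk1, hk2, hk3⟩ => hT kj ⟨i, hk1, hk2, hk3.trans (by rw [hd]; linarith)⟩))
  linarith

/-! ## The R1-at deliverable shape ⇒ the covered cell -/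

/-- **One-sided in-layer row count ⇒ the covered cell inequality (bottom plate).**  R1-at's deliverable shape for plate 1 — per cell, `m ≥ 0` and
a finite `T ⊇` {rows `(k, j)` of plate 1 with a site `L₁(layerSite σ₁ L₁ e₃ k i j) + s₁` in `[−R₀−4, −R₀−3] × {lateral ≤ ρ − m}`} with
`#T + 18mρ ≤ Σ_PAY(12 − deg) + C_w(1+h)ρ` — gives `BilayerWallAt ((C_w + 80(R₀+9) + 3456 + 1152(R₀+1))/2) R₀` for every table dominated by half
plate 1's layer flux (`c i j ≤ layerFlux τ₀ L₁ e₃ / 2`, `τ₀ ≥ 1/4`, `R₀ ≥ 3`). -/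
theorem bilayerWallAt_of_lineCount_layerRows {σ₁ σ₂ : ℤ → ℤ} (hσ₁ : IsHaggSeq σ₁) (hσ₂ : IsHaggSeq σ₂)
    (L₁ L₂ : E3 ≃ₗᵢ[ℝ] E3) (s₁ s₂ : E3) (τ₀ R₀ C_w : ℝ) (hτ₀ : 1 / 4 ≤ τ₀) (hR₀ : 3 ≤ R₀)
    (c : ℤ → ℤ → ℝ) (hc0 : ∀ i j, 0 ≤ c i j) (hdom : ∀ i j, c i j ≤ layerFlux τ₀ L₁ e₃ / 2)
    (hF : ∀ h : ℝ, 0 ≤ h → ∀ ρ : ℝ, R₀ ≤ ρ → ∀ X P₁ P₂ : Finset E3,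
      (∀ p ∈ X, ∀ q ∈ X, p ≠ q → 1 ≤ dist p q) → P₁ ⊆ X → P₂ ⊆ X \ P₁ → (∀ p ∈ X, p ∈ cyl R₀ h ρ) →
      (∀ p, p ∈ P₁ ↔ (p ∈ stacking L₁ s₁ σ₁ ∧ -(2 * R₀) ≤ p 2 ∧ p 2 ≤ -R₀ ∧ p 0 ^ 2 + p 1 ^ 2 ≤ ρ ^ 2)) →
      (∀ p, p ∈ P₂ ↔ (p ∈ stacking L₂ s₂ σ₂ ∧ h + R₀ ≤ p 2 ∧ p 2 ≤ h + 2 * R₀ ∧ p 0 ^ 2 + p 1 ^ 2 ≤ ρ ^ 2)) →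
      ∃ (m : ℝ) (T : Finset (ℤ × ℤ)), 0 ≤ m ∧
        (∀ kj : ℤ × ℤ, (∃ i : ℤ,
          -R₀ - 4 ≤ (L₁ (layerSite σ₁ L₁ e₃ kj.1 i kj.2) + s₁) 2 ∧ (L₁ (layerSite σ₁ L₁ e₃ kj.1 i kj.2) + s₁) 2 ≤ -R₀ - 3 ∧
          Real.sqrt ((L₁ (layerSite σ₁ L₁ e₃ kj.1 i kj.2) + s₁) 0 ^ 2 + (L₁ (layerSite σ₁ L₁ e₃ kj.1 i kj.2) + s₁) 1 ^ 2) ≤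
            ρ - m) → kj ∈ T) ∧
        (T.card : ℝ) + 18 * m * ρ ≤
          (∑ y ∈ X.filter (fun y => (X.filter fun q => dist y q = 1).card ≠ 12 ∧ -R₀ - 2 ≤ y 2 ∧ y 2 ≤ h + R₀ + 2),
            ((12 : ℝ) - ((X.filter fun q => dist y q = 1).card : ℝ))) + C_w * (1 + h) * ρ) :
    BilayerWallAt ((C_w + 80 * (R₀ + 9) + 3456 + 1152 * (R₀ + 1)) / 2) R₀ σ₁ σ₂ L₁ L₂ s₁ s₂ c := by
  classical
  have hR₀1 : 1 ≤ R₀ := by linarith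
  refine bilayerWallAt_of_payerBound hσ₁ hσ₂ L₁ L₂ s₁ s₂ R₀ (C_w + 80 * (R₀ + 9)) hR₀ c ?_
  intro h hh ρ hρ X P₁ P₂ hX hP₁X hP₂X hcell hP₁ hP₂
  obtain ⟨m, T, hm, hT, hcount⟩ := hF h hh ρ hρ X P₁ P₂ hX hP₁X hP₂X hcell hP₁ hP₂
  have hρ0 : 0 ≤ ρ := by linarith
  have hcellbound := cell_charge_le_lines_layerRows_margin σ₁ L₁ L₂ s₁ s₂ τ₀ R₀ h ρ hτ₀ hR₀1 hh hρ0 c hc0 hdom m hm T hT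
  have hset : ({q : E3 | 0 ≤ q 2 ∧ q 2 ≤ 1 ∧ q 0 ^ 2 + q 1 ^ 2 ≤ ρ ^ 2} : Set E3) = wallSlice ρ := rfl
  rw [hset]
  have hsplit : (C_w + 80 * (R₀ + 9)) * (1 + h) * ρ = C_w * (1 + h) * ρ + 80 * (R₀ + 9) * (1 + h) * ρ := by ring
  rw [hsplit]
  linarith

/-- **One-sided in-layer row count ⇒ the covered cell inequality (top plate)**, the twin for plate 2 (rows toward `−e₃`, window
`[h+R₀+3, h+R₀+4]`). -/
theorem bilayerWallAt_of_lineCount_layerRows_top {σ₁ σ₂ : ℤ → ℤ} (hσ₁ : IsHaggSeq σ₁) (hσ₂ : IsHaggSeq σ₂)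
    (L₁ L₂ : E3 ≃ₗᵢ[ℝ] E3) (s₁ s₂ : E3) (τ₀ R₀ C_w : ℝ) (hτ₀ : 1 / 4 ≤ τ₀) (hR₀ : 3 ≤ R₀)
    (c : ℤ → ℤ → ℝ) (hc0 : ∀ i j, 0 ≤ c i j) (hdom : ∀ i j, c i j ≤ layerFlux τ₀ L₂ (-e₃) / 2)
    (hF : ∀ h : ℝ, 0 ≤ h → ∀ ρ : ℝ, R₀ ≤ ρ → ∀ X P₁ P₂ : Finset E3,
      (∀ p ∈ X, ∀ q ∈ X, p ≠ q → 1 ≤ dist p q) → P₁ ⊆ X → P₂ ⊆ X \ P₁ → (∀ p ∈ X, p ∈ cyl R₀ h ρ) →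
      (∀ p, p ∈ P₁ ↔ (p ∈ stacking L₁ s₁ σ₁ ∧ -(2 * R₀) ≤ p 2 ∧ p 2 ≤ -R₀ ∧ p 0 ^ 2 + p 1 ^ 2 ≤ ρ ^ 2)) →
      (∀ p, p ∈ P₂ ↔ (p ∈ stacking L₂ s₂ σ₂ ∧ h + R₀ ≤ p 2 ∧ p 2 ≤ h + 2 * R₀ ∧ p 0 ^ 2 + p 1 ^ 2 ≤ ρ ^ 2)) →
      ∃ (m : ℝ) (T : Finset (ℤ × ℤ)), 0 ≤ m ∧
        (∀ kj : ℤ × ℤ, (∃ i : ℤ,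
          h + R₀ + 3 ≤ (L₂ (layerSite σ₂ L₂ (-e₃) kj.1 i kj.2) + s₂) 2 ∧
          (L₂ (layerSite σ₂ L₂ (-e₃) kj.1 i kj.2) + s₂) 2 ≤ h + R₀ + 4 ∧
          Real.sqrt ((L₂ (layerSite σ₂ L₂ (-e₃) kj.1 i kj.2) + s₂) 0 ^ 2 +
            (L₂ (layerSite σ₂ L₂ (-e₃) kj.1 i kj.2) + s₂) 1 ^ 2) ≤ ρ - m) → kj ∈ T) ∧
        (T.card : ℝ) + 18 * m * ρ ≤
          (∑ y ∈ X.filter (fun y => (X.filter fun q => dist y q = 1).card ≠ 12 ∧ -R₀ - 2 ≤ y 2 ∧ y 2 ≤ h + R₀ + 2),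
            ((12 : ℝ) - ((X.filter fun q => dist y q = 1).card : ℝ))) + C_w * (1 + h) * ρ) :
    BilayerWallAt ((C_w + 80 * (R₀ + 9) + 3456 + 1152 * (R₀ + 1)) / 2) R₀ σ₁ σ₂ L₁ L₂ s₁ s₂ c := by
  classical
  have hR₀1 : 1 ≤ R₀ := by linarith
  refine bilayerWallAt_of_payerBound hσ₁ hσ₂ L₁ L₂ s₁ s₂ R₀ (C_w + 80 * (R₀ + 9)) hR₀ c ?_
  intro h hh ρ hρ X P₁ P₂ hX hP₁X hP₂X hcell hP₁ hP₂
  obtain ⟨m, T, hm, hT, hcount⟩ := hF h hh ρ hρ X P₁ P₂ hX hP₁X hP₂X hcell hP₁ hP₂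
  have hρ0 : 0 ≤ ρ := by linarith
  have hcellbound := cell_charge_le_lines_layerRows_margin_top σ₂ L₁ L₂ s₁ s₂ τ₀ R₀ h ρ hτ₀ hR₀1 hh hρ0 c hc0 hdom m hm T hT
  have hset : ({q : E3 | 0 ≤ q 2 ∧ q 2 ≤ 1 ∧ q 0 ^ 2 + q 1 ^ 2 ≤ ρ ^ 2} : Set E3) = wallSlice ρ := rfl
  rw [hset]
  have hsplit : (C_w + 80 * (R₀ + 9)) * (1 + h) * ρ = C_w * (1 + h) * ρ + 80 * (R₀ + 9) * (1 + h) * ρ := by ring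
  rw [hsplit]
  linarith

/-! ## The domination on the sliver: tilt ⇒ the in-layer flux pays `13/25` one-sidedly -/

/-- **Steep axis ⇒ in-layer domination.**  If `⟪L e₃, e⟫² ≤ 1/4` (axis at least `60°` from the unit wall normal `e`; the flux sliver even has
`< 1/20`, p714812), then `layerRise L e ≥ 3/4`, so `layerFlux τ₀ L e = √2·layerRise L e ≥ (3/4)√2 > 2·(13/25)` for every `τ₀ ≤ 3/4`: the constant
table `13/25` (and every admissible table at that cap) is dominated by HALF the in-layer flux. -/
theorem c0_le_half_layerFlux_of_tilt (L : E3 ≃ₗᵢ[ℝ] E3) {e : E3} (he : ‖e‖ = 1) (htilt : ⟪L e₃, e⟫_ℝ ^ 2 ≤ 1 / 4) {τ₀ : ℝ}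
    (hτ₀ : τ₀ ≤ 3 / 4) : (13 / 25 : ℝ) ≤ layerFlux τ₀ L e / 2 := by
  have hν : ‖L.symm e‖ = 1 := by rw [LinearIsometryEquiv.norm_map, he]
  have he3 : (e₃ : E3) = EuclideanSpace.single (2 : Fin 3) (1 : ℝ) := rfl
  have h1 : ⟪L e₃, e⟫_ℝ = ⟪e₃, L.symm e⟫_ℝ := by
    rw [← LinearIsometryEquiv.inner_map_map L e₃ (L.symm e), LinearIsometryEquiv.apply_symm_apply]
  have hν2 : (L.symm e) 2 = ⟪L e₃, e⟫_ℝ := by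
    rw [h1, he3, EuclideanSpace.inner_single_left]
    simp
  have hlat := three_quarters_lateral_le_layerRise_sq L e
  have hunit : (L.symm e) 0 ^ 2 + (L.symm e) 1 ^ 2 + (L.symm e) 2 ^ 2 = 1 := by
    have h := real_inner_self_eq_norm_sq (L.symm e)
    have h' : ∀ a b : E3, ⟪a, b⟫_ℝ = a 0 * b 0 + a 1 * b 1 + a 2 * b 2 := fun a b => by
      simp [PiLp.inner_apply, Fin.sum_univ_three, mul_comm]
    rw [hν, one_pow, h'] at h
    linear_combination h
  have hr0 : 0 ≤ layerRise L e := Summit.Ventures.Crystal3D.Cruxes.TextureLiminf.TexShadow.layerRise_nonneg L e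
  have hr2 : 9 / 16 ≤ layerRise L e ^ 2 := by
    rw [hν2] at hunit
    nlinarith
  have hr : 3 / 4 ≤ layerRise L e := by nlinarith
  unfold layerFlux
  rw [if_pos (hτ₀.trans hr)]
  have hs : (1.4 : ℝ) ≤ Real.sqrt 2 := by
    rw [show (1.4 : ℝ) = Real.sqrt (1.4 ^ 2) by rw [Real.sqrt_sq (by norm_num)]]
    exact Real.sqrt_le_sqrt (by norm_num)
  nlinarith

end Summit.Ventures.Crystal3D.Theorems

end
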